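import Summits.CriticalPhenomena.PercolationContinuityZ3.Theorems.PercNearOneGluingNoHeavyQuantIndepBlobMoments
import HarnessLib

/-!
# QUANT lane R8, FAR for independent blobs (VII): DISCOUNTED LIGHT BLOBS when the floor is `≤ 1/2` —
# Conjecture DIB* (census-2 gen 49) holds in the Cantelli regime, for any number of heavy and light blobs

builds on p205010 (kernel theorem, internal audit signed; external expert review pending)

Support file (`--supports stmt-CriticalPhenomena-4575`), QUANT lane lead (gen 15); memo
`run/shared/lean/prim/quant/prim-quant-lead-g15/LEAD-NOTES-G15.md` N27–N28; architecture of record README V185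
(`run/shared/lean/prim/quant/prim-quant-census-2-g49/ARCH-TREES-G49.md` §3).  Theorems only, no definitions, no sorries, standard axioms;
vocabulary of `…QuantIndepBlobMoments` (product weights `∏ (if k ∈ W then p k else 1 − p k)` on the finsets of a finite type).

**Conjecture DIB*** (the one probabilistic input of the reduction of `Quant.FarTreeRow` to independent blobs): independent blobs with weights
`a_i ≥ 0` and gates `p_i`; a FLOOR `p₀`; HEAVY blobs have `p_i ≥ p₀` and are credited `a_i p_i`, LIGHT blobs have `p_i ≤ p₀` and are credited at the
DISCOUNT `a_i · κ(p_i)`, `κ(g) = (g − p₀²)/(1 − p₀)` (a light blob at gate `p₀²` is worth nothing); if the credited mean `m_c` exceeds `2j` and no light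
blob is a giant then `P(Σ_{i∈W} a_i ≤ j) ≤ 1 − p₀`.  Without light blobs this is `IndepBlob.far_indepBlob(_min)`.  This file proves DIB* whenever
`p₀ ≤ 1/2`, by re-running the Cantelli half of the half-mean small-ball inequality (`halfMean_smallBall_of_gate_le_half`) with the TRUE mean
`m ≥ m_c` and the observation that the discount pays exactly for the larger variance of a light blob:
`g(1 − g) ≤ (1 − p₀)(2g − κ(g))  ⟺  0 ≤ (g − p₀)²`.

* `Quant.IndepBlob.discounted_smallBall_of_le_half` — `0 ≤ p₀ ≤ 1/2`, heavy set `H` (`p₀ ≤ p i` on `H`, `p i ≤ p₀` off `H`), all weights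
  `a i ≤ m_c/2`: `Σ_{W : a(W) < m_c/2} w(W) ≤ 1 − p₀`.  Proof: with `t = m_c/2`, `m = Σ a p`, `s = m − t`: `s − t = m − m_c = Σ_{light} a·p₀(p₀ − p)/(1 − p₀) ≥ 0`;
  `V = Σ a²p(1−p) ≤ t·[(1−p₀)Σ_H a p + Σ_L a(1−p₀)(2p − κ)] = 2(1 − p₀)·t·s ≤ 2(1−p₀)s²`; Cantelli at deviation `s` from the true mean gives
  `P ≤ V/(V + s²)`, whence `P ≤ 2(1−p₀)(1 − P)` and `P ≤ 1 − p₀` as `p₀ ≤ 1/2`.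
* `Quant.IndepBlob.dibStar_of_le_half` — **DIB* for floors `≤ 1/2`**: if `2j < m_c` and every LIGHT blob has `a i ≤ j`, then `P(a(W) ≤ j) ≤ 1 − p₀`
  (a heavy blob heavier than `m_c/2 > j` decides alone: `{a(W) ≤ j} ⊆ {i ∉ W}`, probability `1 − p i ≤ 1 − p₀`).
The other half of DIB* (`p₀ ≥ 1/2`, Hall–Harris transports with light gates riding along) is open; its first cases are `IndepBlob.tail_ge_gate_of_two_mul_le_size`
(heavy total `≥ 2j+2`) and the companion row `…QuantIndepBlobCompanionRow` (heavy total `2j+1`, companion gate `≥ 1/2`).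
Exact second check (lead g15, `prim-quant-lead-g15/explore/dib.py`, `dib3.py`, `diblow.py`): 0 violations; the regime `p₀ ≤ 1/2` has visible slack.
[cite: KozmaNitzan2024, Conjecture 3 (p. 15)] (the gluing rows served); [this work].
-/

namespace Summit.CriticalPhenomena.PercolationContinuityZ3.Theorems

namespace Quant

namespace IndepBlob

open Finset

variable {ι : Type*} [Fintype ι] [DecidableEq ι]

/-- **Discounted half-mean small-ball inequality, floor `≤ 1/2`.**  Gates `0 ≤ p i ≤ 1`, weights `a i ≥ 0`, a floor `0 ≤ p₀ ≤ 1/2`, a set `H`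
of heavy blobs (`p₀ ≤ p i` for `i ∈ H`, `p i ≤ p₀` for `i ∉ H`); credited mean
`m_c = Σ_{i∈H} a i p i + Σ_{i∉H} a i (p i − p₀²)/(1 − p₀)`.  If every weight is `≤ m_c/2` then `Σ_{W : a(W) < m_c/2} w(W) ≤ 1 − p₀`. [this work] -/
theorem discounted_smallBall_of_le_half (p a : ι → ℝ) (p₀ : ℝ) (hp₀ : 0 ≤ p₀) (hhalf : p₀ ≤ 1 / 2)
    (hp0 : ∀ i, 0 ≤ p i) (hp1 : ∀ i, p i ≤ 1) (ha : ∀ i, 0 ≤ a i) (H : Finset ι)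
    (hH : ∀ i ∈ H, p₀ ≤ p i) (hL : ∀ i, i ∉ H → p i ≤ p₀)
    (hA : ∀ i, a i ≤ ((∑ i ∈ H, a i * p i) + ∑ i ∈ Hᶜ, a i * ((p i - p₀ ^ 2) / (1 - p₀))) / 2) :
    ∑ W ∈ (Finset.univ : Finset (Finset ι)).filter
        (fun W => ∑ i ∈ W, a i < ((∑ i ∈ H, a i * p i) + ∑ i ∈ Hᶜ, a i * ((p i - p₀ ^ 2) / (1 - p₀))) / 2),
      (∏ k, if k ∈ W then p k else 1 - p k) ≤ 1 - p₀ := by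
  set mc : ℝ := (∑ i ∈ H, a i * p i) + ∑ i ∈ Hᶜ, a i * ((p i - p₀ ^ 2) / (1 - p₀)) with hmc
  set t : ℝ := mc / 2 with ht
  set m : ℝ := ∑ i, a i * p i with hm
  set s : ℝ := m - t with hs
  set V : ℝ := ∑ i, a i ^ 2 * p i * (1 - p i) with hV
  set K := (Finset.univ : Finset (Finset ι)).filter (fun W => ∑ i ∈ W, a i < t) with hK
  set P : ℝ := ∑ W ∈ K, (∏ k, if k ∈ W then p k else 1 - p k) with hP
  show P ≤ 1 - p₀
  have hf0 : 0 < 1 - p₀ := by linarith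
  have hw0 : ∀ W, 0 ≤ (∏ k, if k ∈ W then p k else 1 - p k) := bernoulliWeight_nonneg hp0 hp1
  have hP0 : 0 ≤ P := Finset.sum_nonneg fun W _ => hw0 W
  have hP1 : P ≤ 1 := by
    rw [← sum_bernoulliWeight p]
    exact Finset.sum_le_sum_of_subset_of_nonneg (Finset.filter_subset _ _) fun W _ _ => hw0 W
  -- the discount: `m − m_c = Σ_{light} a·p₀(p₀ − p)/(1 − p₀) ≥ 0`, so `s ≥ t`
  have hsplit_m : m = (∑ i ∈ H, a i * p i) + ∑ i ∈ Hᶜ, a i * p i := by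
    rw [hm, ← Finset.sum_add_sum_compl H]
  have hlight_le : ∀ i, i ∉ H → a i * ((p i - p₀ ^ 2) / (1 - p₀)) ≤ a i * p i := by
    intro i hi
    refine mul_le_mul_of_nonneg_left ?_ (ha i)
    rw [div_le_iff₀ hf0]
    nlinarith [hL i hi, hp0 i, hp₀]
  have hmc_le_m : mc ≤ m := by
    rw [hsplit_m, hmc]
    refine add_le_add le_rfl (Finset.sum_le_sum fun i hi => hlight_le i (Finset.mem_compl.1 hi))
  have hts : t ≤ s := by rw [hs, ht]; linarith
  -- degenerate case `t ≤ 0`: the event is empty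
  rcases le_or_gt t 0 with ht0 | htpos
  · have hK0 : P = 0 := by
      refine Finset.sum_eq_zero fun W hW => ?_
      rw [hK, Finset.mem_filter] at hW
      have : 0 ≤ ∑ i ∈ W, a i := Finset.sum_nonneg fun i _ => ha i
      linarith [hW.2]
    rw [hK0]; linarith
  have hspos : 0 < s := lt_of_lt_of_le htpos hts
  -- the variance bound `V ≤ 2 (1 − p₀) · t · s`
  have hVle : V ≤ 2 * (1 - p₀) * t * s := by
    -- per-blob bounds
    have hheavy : ∀ i ∈ H, a i ^ 2 * p i * (1 - p i) ≤ t * (1 - p₀) * (a i * p i) := by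
      intro i hi
      have hpi0 : 0 ≤ p i := hp0 i
      have e1 : a i ^ 2 * p i * (1 - p i) ≤ a i ^ 2 * p i * (1 - p₀) := by
        have : 1 - p i ≤ 1 - p₀ := by linarith [hH i hi]
        exact mul_le_mul_of_nonneg_left this (by positivity)
      have e2 : a i ^ 2 * p i * (1 - p₀) ≤ t * (1 - p₀) * (a i * p i) := by
        have c0 : 0 ≤ a i * p i * (1 - p₀) := mul_nonneg (mul_nonneg (ha i) hpi0) hf0.le
        have := mul_le_mul_of_nonneg_right (hA i) c0
        calc a i ^ 2 * p i * (1 - p₀) = a i * (a i * p i * (1 - p₀)) := by ring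
          _ ≤ t * (a i * p i * (1 - p₀)) := by rw [ht]; exact this
          _ = t * (1 - p₀) * (a i * p i) := by ring
      exact e1.trans e2
    have hlight : ∀ i ∈ Hᶜ, a i ^ 2 * p i * (1 - p i) ≤
        t * (1 - p₀) * (2 * (a i * p i) - a i * ((p i - p₀ ^ 2) / (1 - p₀))) := by
      intro i hi
      have hpi0 : 0 ≤ p i := hp0 i
      -- the discount identity: `(1 − p₀)(2g − κ(g)) − g(1 − g) = (g − p₀)²`
      have key : p i * (1 - p i) ≤ (1 - p₀) * (2 * p i - (p i - p₀ ^ 2) / (1 - p₀)) := by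
        have e : (1 - p₀) * (2 * p i - (p i - p₀ ^ 2) / (1 - p₀)) = p i * (1 - p i) + (p i - p₀) ^ 2 := by
          field_simp
          ring
        rw [e]
        nlinarith [sq_nonneg (p i - p₀)]
      have e1 : a i ^ 2 * p i * (1 - p i) ≤ t * (a i * (p i * (1 - p i))) := by
        have c0 : 0 ≤ a i * (p i * (1 - p i)) := mul_nonneg (ha i) (mul_nonneg hpi0 (by linarith [hp1 i]))
        have := mul_le_mul_of_nonneg_right (hA i) c0
        calc a i ^ 2 * p i * (1 - p i) = a i * (a i * (p i * (1 - p i))) := by ring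
          _ ≤ t * (a i * (p i * (1 - p i))) := by rw [ht]; exact this
      have e2 : t * (a i * (p i * (1 - p i))) ≤ t * (a i * ((1 - p₀) * (2 * p i - (p i - p₀ ^ 2) / (1 - p₀)))) :=
        mul_le_mul_of_nonneg_left (mul_le_mul_of_nonneg_left key (ha i)) htpos.le
      calc a i ^ 2 * p i * (1 - p i) ≤ t * (a i * ((1 - p₀) * (2 * p i - (p i - p₀ ^ 2) / (1 - p₀)))) := e1.trans e2
        _ = t * (1 - p₀) * (2 * (a i * p i) - a i * ((p i - p₀ ^ 2) / (1 - p₀))) := by ring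
    have hsum : V ≤ t * (1 - p₀) * (∑ i ∈ H, a i * p i) +
        t * (1 - p₀) * (2 * (∑ i ∈ Hᶜ, a i * p i) - ∑ i ∈ Hᶜ, a i * ((p i - p₀ ^ 2) / (1 - p₀))) := by
      rw [hV, ← Finset.sum_add_sum_compl H]
      have h1 : ∑ i ∈ H, a i ^ 2 * p i * (1 - p i) ≤ t * (1 - p₀) * (∑ i ∈ H, a i * p i) := by
        rw [Finset.mul_sum]; exact Finset.sum_le_sum hheavy
      have h2 : ∑ i ∈ Hᶜ, a i ^ 2 * p i * (1 - p i) ≤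
          t * (1 - p₀) * (2 * (∑ i ∈ Hᶜ, a i * p i) - ∑ i ∈ Hᶜ, a i * ((p i - p₀ ^ 2) / (1 - p₀))) := by
        rw [Finset.mul_sum, ← Finset.sum_sub_distrib, Finset.mul_sum]
        exact Finset.sum_le_sum hlight
      exact add_le_add h1 h2
    have e : t * (1 - p₀) * (∑ i ∈ H, a i * p i) +
        t * (1 - p₀) * (2 * (∑ i ∈ Hᶜ, a i * p i) - ∑ i ∈ Hᶜ, a i * ((p i - p₀ ^ 2) / (1 - p₀))) = 2 * (1 - p₀) * t * s := by
      rw [hs, hsplit_m, ht, hmc]; ring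
    rw [← e]; exact hsum
  have hV0 : 0 ≤ V := Finset.sum_nonneg fun i _ => by
    have hpi0 : 0 ≤ p i := hp0 i
    have : 0 ≤ 1 - p i := by linarith [hp1 i]
    positivity
  -- Cantelli at deviation `s` from the true mean: `(s + u)² P ≤ V + u²`
  have cantelli : ∀ u : ℝ, 0 ≤ u → (s + u) ^ 2 * P ≤ V + u ^ 2 := by
    intro u hu
    have q0 := sum_bernoulliWeight_mul_sq_sub p a (m + u)
    rw [← hm] at q0
    have b0 : (s + u) ^ 2 * P ≤ ∑ W : Finset ι, (∏ k, if k ∈ W then p k else 1 - p k) * (m + u - ∑ i ∈ W, a i) ^ 2 := by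
      rw [hP, Finset.mul_sum]
      calc ∑ W ∈ K, (s + u) ^ 2 * (∏ k, if k ∈ W then p k else 1 - p k)
          ≤ ∑ W ∈ K, (∏ k, if k ∈ W then p k else 1 - p k) * (m + u - ∑ i ∈ W, a i) ^ 2 := by
            refine Finset.sum_le_sum fun W hW => ?_
            rw [hK, Finset.mem_filter] at hW
            have hge : s + u ≤ m + u - ∑ i ∈ W, a i := by rw [hs]; linarith [hW.2]
            have hsq : (s + u) ^ 2 ≤ (m + u - ∑ i ∈ W, a i) ^ 2 :=
              pow_le_pow_left₀ (by linarith) hge 2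
            rw [mul_comm]
            exact mul_le_mul_of_nonneg_left hsq (hw0 W)
        _ ≤ ∑ W : Finset ι, (∏ k, if k ∈ W then p k else 1 - p k) * (m + u - ∑ i ∈ W, a i) ^ 2 :=
            Finset.sum_le_sum_of_subset_of_nonneg (Finset.filter_subset _ _)
              fun W _ _ => mul_nonneg (hw0 W) (sq_nonneg _)
    have e : (m + u - m) ^ 2 + V = V + u ^ 2 := by ring
    calc (s + u) ^ 2 * P ≤ ∑ W : Finset ι, (∏ k, if k ∈ W then p k else 1 - p k) * (m + u - ∑ i ∈ W, a i) ^ 2 := b0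
      _ = (m + u - m) ^ 2 + V := by rw [q0]
      _ = V + u ^ 2 := e
  -- choose `u = V / s`
  have hc := cantelli (V / s) (div_nonneg hV0 hspos.le)
  have hsne : s ≠ 0 := hspos.ne'
  have e3 : (s + V / s) * s = s ^ 2 + V := by
    field_simp
  have lhs : (s + V / s) ^ 2 * P * s ^ 2 = (s ^ 2 + V) ^ 2 * P := by
    rw [← e3]; ring
  have rhs : (V + (V / s) ^ 2) * s ^ 2 = V * (s ^ 2 + V) := by
    field_simp
  have h4 : (s ^ 2 + V) ^ 2 * P ≤ V * (s ^ 2 + V) := by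
    have := mul_le_mul_of_nonneg_right hc (sq_nonneg s)
    rw [lhs, rhs] at this
    exact this
  have hpos : 0 < s ^ 2 + V := by positivity
  have key : (s ^ 2 + V) * P ≤ V := by
    have h5 : (s ^ 2 + V) * ((s ^ 2 + V) * P) ≤ (s ^ 2 + V) * V := by
      calc (s ^ 2 + V) * ((s ^ 2 + V) * P) = (s ^ 2 + V) ^ 2 * P := by ring
        _ ≤ V * (s ^ 2 + V) := h4
        _ = (s ^ 2 + V) * V := by ring
    exact le_of_mul_le_mul_left h5 hpos
  -- conclude: `s² P ≤ V (1 − P) ≤ 2(1−p₀) s² (1 − P)` (using `t ≤ s`), so `P ≤ 2(1−p₀)(1−P)`, so `P ≤ 1 − p₀`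
  have hs2 : 0 < s ^ 2 := by positivity
  have hVle' : V ≤ 2 * (1 - p₀) * s ^ 2 := by
    have : 2 * (1 - p₀) * t * s ≤ 2 * (1 - p₀) * s * s := by
      have c0 : 0 ≤ 2 * (1 - p₀) * s := by positivity
      nlinarith [hts, c0]
    calc V ≤ 2 * (1 - p₀) * t * s := hVle
      _ ≤ 2 * (1 - p₀) * s * s := this
      _ = 2 * (1 - p₀) * s ^ 2 := by ring
  have s1 : s ^ 2 * P ≤ V * (1 - P) := by linear_combination key
  have s2 : V * (1 - P) ≤ 2 * (1 - p₀) * s ^ 2 * (1 - P) := mul_le_mul_of_nonneg_right hVle' (by linarith)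
  have s3 : P ≤ 2 * (1 - p₀) * (1 - P) := by
    refine le_of_mul_le_mul_left ?_ hs2
    calc s ^ 2 * P ≤ 2 * (1 - p₀) * s ^ 2 * (1 - P) := s1.trans s2
      _ = s ^ 2 * (2 * (1 - p₀) * (1 - P)) := by ring
  have s4 : P * (1 + 2 * (1 - p₀)) ≤ (1 - p₀) * (1 + 2 * (1 - p₀)) := by nlinarith [s3, hhalf, hf0]
  exact le_of_mul_le_mul_right s4 (by linarith)

/-- **DIB* for floors `≤ 1/2` (Conjecture DIB* of census-2 gen 49, Cantelli regime).**  Gates `0 ≤ p i ≤ 1`, weights `a i ≥ 0`, floor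
`0 ≤ p₀ ≤ 1/2`, heavy set `H` (`p₀ ≤ p i` on `H`, `p i ≤ p₀` off `H`), credited mean
`m_c = Σ_{i∈H} a i p i + Σ_{i∉H} a i (p i − p₀²)/(1 − p₀)`; a level `j` with `2j < m_c` such that every LIGHT blob has `a i ≤ j` (no light giant).
Then `Σ_{W : a(W) ≤ j} w(W) ≤ 1 − p₀`: the lower tail at layer `j` is at most the closing probability of the floor.  (A heavy blob of weight
`> m_c/2 > j` decides alone; otherwise `discounted_smallBall_of_le_half`.) [this work] -/
theorem dibStar_of_le_half (p a : ι → ℝ) (p₀ : ℝ) (hp₀ : 0 ≤ p₀) (hhalf : p₀ ≤ 1 / 2)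
    (hp0 : ∀ i, 0 ≤ p i) (hp1 : ∀ i, p i ≤ 1) (ha : ∀ i, 0 ≤ a i) (H : Finset ι)
    (hH : ∀ i ∈ H, p₀ ≤ p i) (hL : ∀ i, i ∉ H → p i ≤ p₀) (j : ℝ)
    (hj : 2 * j < (∑ i ∈ H, a i * p i) + ∑ i ∈ Hᶜ, a i * ((p i - p₀ ^ 2) / (1 - p₀)))
    (hlight : ∀ i, i ∉ H → a i ≤ j) :
    ∑ W ∈ (Finset.univ : Finset (Finset ι)).filter (fun W => ∑ i ∈ W, a i ≤ j),
      (∏ k, if k ∈ W then p k else 1 - p k) ≤ 1 - p₀ := by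
  set mc : ℝ := (∑ i ∈ H, a i * p i) + ∑ i ∈ Hᶜ, a i * ((p i - p₀ ^ 2) / (1 - p₀)) with hmc
  have hw0 : ∀ W, 0 ≤ (∏ k, if k ∈ W then p k else 1 - p k) := bernoulliWeight_nonneg hp0 hp1
  by_cases hbig : ∃ i ∈ H, mc / 2 < a i
  · -- a heavy giant decides
    obtain ⟨i, hiH, hi⟩ := hbig
    have hsub : ∑ W ∈ (Finset.univ : Finset (Finset ι)).filter (fun W => ∑ i ∈ W, a i ≤ j),
        (∏ k, if k ∈ W then p k else 1 - p k) ≤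
        ∑ W ∈ (Finset.univ : Finset (Finset ι)).filter (fun W => i ∉ W), (∏ k, if k ∈ W then p k else 1 - p k) := by
      refine Finset.sum_le_sum_of_subset_of_nonneg (fun W hW => ?_) fun W _ _ => hw0 W
      rw [Finset.mem_filter] at hW ⊢
      refine ⟨hW.1, fun hiW => ?_⟩
      have : a i ≤ ∑ k ∈ W, a k := Finset.single_le_sum (fun k _ => ha k) hiW
      linarith [hW.2]
    refine hsub.trans ?_
    rw [sum_bernoulliWeight_filter_not_mem p i]
    linarith [hH i hiH]
  · push Not at hbig
    have hA : ∀ i, a i ≤ mc / 2 := by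
      intro i
      by_cases hi : i ∈ H
      · exact hbig i hi
      · exact (hlight i hi).trans (by linarith)
    have hmain := discounted_smallBall_of_le_half p a p₀ hp₀ hhalf hp0 hp1 ha H hH hL hA
    refine le_trans ?_ hmain
    refine Finset.sum_le_sum_of_subset_of_nonneg (fun W hW => ?_) fun W _ _ => hw0 W
    rw [Finset.mem_filter] at hW ⊢
    exact ⟨hW.1, by linarith [hW.2]⟩

end IndepBlob

end Quant

end Summit.CriticalPhenomena.PercolationContinuityZ3.Theorems
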